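import Mathlib

/-!
# Product-plus-one line — CLOUD CORE in lens currency, IV: the SYMMETRIC envelope `e^{(a-b)u}` and the
# COMPATIBILITY LAW (in-phase rows, and out-of-phase rows that are flat, never create a sign change)

Helper file for `stmt-ValiantsHypothesis-18050` (`MatrixDescartes`), line `product_plus_one`, floor
`stub_oneChangeFloorK3`, open core (CL-F1) (clouds).  Sequel of `…LensCloudEnvelope` (p827068), `…LensCloudSwitch`
(p827257), `…LensCloudTop` (p827289); same dictionary (p3 g20 NOTE §8): cloud `(κ, p, r)`, phase
`y(u) = κ + p e^{-au} + r e^{bu}`, velocity `y' = -a p e^{-au} + b r e^{bu}`, company phase velocity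
`Θ' = Σ_i y_i'/(1+y_i²) = -F₁`.  Def-free, Mathlib only.  Nothing here closes a stub; VP ≠ VNP is not touched.

## What is proved
* SYMMETRIC ENVELOPE (`hasDerivAt_symSummand`): for every row and every sign pattern,
  `(d/du)[ e^{(a-b)u} · y'/(1+y²) ] = -e^{(a-b)u} · ( ab·(κ - y)·(1+y²) + 2·y·y'² ) / (1+y²)²`,
  where `κ - y = -p e^{-au} - r e^{bu}` is the DEPTH below the common phase ceiling `κ = cot(πa/c)` (positive for every
  T5 cloud at every `u`).  The multiplier `e^{(a-b)u}` removes the `y'`-term exactly (the lower / upper envelopes of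
  the earlier files are the one-sided versions).
* COMPATIBILITY LAW (`symSummand_deriv_nonpos_of_compatible`, `…_of_inPhase`, `…_of_flat`): call a row COMPATIBLE at `u`
  if `ab(κ - y)(1+y²) + 2 y y'² ≥ 0`.  Sufficient: (i) IN PHASE `0 ≤ y ≤ κ`… precisely `0 ≤ y` and `y ≤ κ`; or
  (ii) OUT OF PHASE BUT FLAT: `y ≤ 0 ≤ κ` and `2 y'² ≤ ab (1+y²)`.  Since `y_i'(u_i*) = 0` at the row's own switch time,
  EVERY cloud is compatible near its own switch, whatever its phase (this covers the weak-middle rows of the real-currency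
  cell `…WeakMiddle` locally).  At a point where every row of the company is compatible (and one T5 row is present),
  `(e^{(a-b)u}Θ')' < 0` (`symVelocity_deriv_neg`); on a convex window of such points `e^{(a-b)u}Θ'` is strictly
  decreasing and `Θ' = -F₁` vanishes at most once (`symVelocity_strictAntiOn`, `phaseVelocity_zero_subsingleton_sym`).
Reading for (CL-1′): an extra sign change of `F₁` needs a window point where some row is simultaneously OUT OF PHASE
(`x_f < 0`) and STEEP (`2 x_f'² > ab(1 + x_f²)` in these units) — far from its own switch on the obtuse side.
-/

set_option linter.dupNamespace false

open Real Finset BigOperators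

namespace Summit.ValiantsHypothesis.ValiantsHypothesis.Theorems.LacunarySymmetroidMatrixDescartes.ProductPlusOne.LensCloudSymmetric

variable {ι : Type*} [Fintype ι]

/-- **Derivative of the symmetric summand** `e^{(a-b)u}·y'/(1+y²)` in closed form. [this file's theorem] -/
theorem hasDerivAt_symSummand (a b κ p r u : ℝ) :
    HasDerivAt (fun u => exp ((a - b) * u) * ((-(a * p) * exp (-(a * u)) + b * r * exp (b * u))
        / (1 + (κ + p * exp (-(a * u)) + r * exp (b * u)) ^ 2)))
      (-(exp ((a - b) * u)
        * (a * b * (-(p * exp (-(a * u))) - r * exp (b * u))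
              * (1 + (κ + p * exp (-(a * u)) + r * exp (b * u)) ^ 2)
            + 2 * (κ + p * exp (-(a * u)) + r * exp (b * u))
              * (-(a * p) * exp (-(a * u)) + b * r * exp (b * u)) ^ 2)
          / (1 + (κ + p * exp (-(a * u)) + r * exp (b * u)) ^ 2) ^ 2)) u := by
  -- the pieces
  have h1 : HasDerivAt (fun u : ℝ => -(a * u)) (-a) u := by
    simpa using (hasDerivAt_id u).const_mul (-a)
  have hE1 : HasDerivAt (fun u : ℝ => exp (-(a * u))) (exp (-(a * u)) * (-a)) u := h1.exp
  have h3 : HasDerivAt (fun u : ℝ => b * u) b u := by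
    simpa using (hasDerivAt_id u).const_mul b
  have hE2 : HasDerivAt (fun u : ℝ => exp (b * u)) (exp (b * u) * b) u := h3.exp
  have h5 : HasDerivAt (fun u : ℝ => (a - b) * u) (a - b) u := by
    simpa using (hasDerivAt_id u).const_mul (a - b)
  have hE3 : HasDerivAt (fun u : ℝ => exp ((a - b) * u)) (exp ((a - b) * u) * (a - b)) u := h5.exp
  have hy : HasDerivAt (fun u => κ + p * exp (-(a * u)) + r * exp (b * u))
      (-(a * p) * exp (-(a * u)) + b * r * exp (b * u)) u :=
    (((hE1.const_mul p).const_add κ).add (hE2.const_mul r)).congr_deriv (by ring)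
  have hnum : HasDerivAt (fun u => -(a * p) * exp (-(a * u)) + b * r * exp (b * u))
      (a * a * p * exp (-(a * u)) + b * b * r * exp (b * u)) u :=
    ((hE1.const_mul (-(a * p))).add (hE2.const_mul (b * r))).congr_deriv (by ring)
  have hden : HasDerivAt (fun u => 1 + (κ + p * exp (-(a * u)) + r * exp (b * u)) ^ 2)
      (2 * (κ + p * exp (-(a * u)) + r * exp (b * u))
        * (-(a * p) * exp (-(a * u)) + b * r * exp (b * u))) u := by
    refine ((hy.pow 2).const_add 1).congr_deriv ?_
    norm_num
  have hne : (1 + (κ + p * exp (-(a * u)) + r * exp (b * u)) ^ 2) ≠ 0 := by positivity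
  have hquot : HasDerivAt (fun u => (-(a * p) * exp (-(a * u)) + b * r * exp (b * u))
      / (1 + (κ + p * exp (-(a * u)) + r * exp (b * u)) ^ 2)) _ u := hnum.div hden hne
  have hall : HasDerivAt (fun u => exp ((a - b) * u) * ((-(a * p) * exp (-(a * u)) + b * r * exp (b * u))
      / (1 + (κ + p * exp (-(a * u)) + r * exp (b * u)) ^ 2))) _ u := hE3.mul hquot
  refine hall.congr_deriv ?_
  field_simp
  ring

/-- **Sign of the symmetric summand's derivative**: it is `≤ 0` exactly when the row is COMPATIBLE,
`0 ≤ ab(κ - y)(1+y²) + 2 y y'²`. [this file's theorem] -/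
theorem symSummand_deriv_nonpos_of_compatible (a b κ p r u : ℝ)
    (hc : 0 ≤ a * b * (-(p * exp (-(a * u))) - r * exp (b * u))
              * (1 + (κ + p * exp (-(a * u)) + r * exp (b * u)) ^ 2)
            + 2 * (κ + p * exp (-(a * u)) + r * exp (b * u))
              * (-(a * p) * exp (-(a * u)) + b * r * exp (b * u)) ^ 2) :
    -(exp ((a - b) * u)
        * (a * b * (-(p * exp (-(a * u))) - r * exp (b * u))
              * (1 + (κ + p * exp (-(a * u)) + r * exp (b * u)) ^ 2)
            + 2 * (κ + p * exp (-(a * u)) + r * exp (b * u))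
              * (-(a * p) * exp (-(a * u)) + b * r * exp (b * u)) ^ 2)
          / (1 + (κ + p * exp (-(a * u)) + r * exp (b * u)) ^ 2) ^ 2) ≤ 0 := by
  rw [neg_nonpos]
  exact div_nonneg (mul_nonneg (exp_pos _).le hc) (by positivity)

/-- strict version: strictly compatible row ⇒ derivative `< 0`. [this file's theorem] -/
theorem symSummand_deriv_neg_of_compatible (a b κ p r u : ℝ)
    (hc : 0 < a * b * (-(p * exp (-(a * u))) - r * exp (b * u))
              * (1 + (κ + p * exp (-(a * u)) + r * exp (b * u)) ^ 2)
            + 2 * (κ + p * exp (-(a * u)) + r * exp (b * u))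
              * (-(a * p) * exp (-(a * u)) + b * r * exp (b * u)) ^ 2) :
    -(exp ((a - b) * u)
        * (a * b * (-(p * exp (-(a * u))) - r * exp (b * u))
              * (1 + (κ + p * exp (-(a * u)) + r * exp (b * u)) ^ 2)
            + 2 * (κ + p * exp (-(a * u)) + r * exp (b * u))
              * (-(a * p) * exp (-(a * u)) + b * r * exp (b * u)) ^ 2)
          / (1 + (κ + p * exp (-(a * u)) + r * exp (b * u)) ^ 2) ^ 2) < 0 := by
  rw [neg_neg_iff_pos]
  exact div_pos (mul_pos (exp_pos _) hc) (by positivity)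

/-- **(i) IN-PHASE rows are compatible**: `0 ≤ a`, `0 ≤ b`, depth `κ - y ≥ 0` (i.e. `p e^{-au} + r e^{bu} ≤ 0`,
automatic for a T5 cloud) and phase `y ≥ 0`. [this file's theorem] -/
theorem compatible_of_inPhase (a b κ p r u : ℝ) (ha : 0 ≤ a) (hb : 0 ≤ b)
    (hdepth : p * exp (-(a * u)) + r * exp (b * u) ≤ 0)
    (hy : 0 ≤ κ + p * exp (-(a * u)) + r * exp (b * u)) :
    0 ≤ a * b * (-(p * exp (-(a * u))) - r * exp (b * u))
              * (1 + (κ + p * exp (-(a * u)) + r * exp (b * u)) ^ 2)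
            + 2 * (κ + p * exp (-(a * u)) + r * exp (b * u))
              * (-(a * p) * exp (-(a * u)) + b * r * exp (b * u)) ^ 2 := by
  have h1 : 0 ≤ a * b * (-(p * exp (-(a * u))) - r * exp (b * u))
      * (1 + (κ + p * exp (-(a * u)) + r * exp (b * u)) ^ 2) := by
    have : 0 ≤ -(p * exp (-(a * u))) - r * exp (b * u) := by linarith
    exact mul_nonneg (mul_nonneg (mul_nonneg ha hb) this) (by positivity)
  have h2 : 0 ≤ 2 * (κ + p * exp (-(a * u)) + r * exp (b * u))
      * (-(a * p) * exp (-(a * u)) + b * r * exp (b * u)) ^ 2 :=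
    mul_nonneg (mul_nonneg (by norm_num) hy) (sq_nonneg _)
  linarith

/-- strict (i): a T5 cloud (`p < 0`, `r ≤ 0`, `0 < a`, `0 < b`) in phase is STRICTLY compatible.
[this file's theorem] -/
theorem strictCompatible_of_inPhase (a b κ p r u : ℝ) (ha : 0 < a) (hb : 0 < b) (hp : p < 0) (hr : r ≤ 0)
    (hy : 0 ≤ κ + p * exp (-(a * u)) + r * exp (b * u)) :
    0 < a * b * (-(p * exp (-(a * u))) - r * exp (b * u))
              * (1 + (κ + p * exp (-(a * u)) + r * exp (b * u)) ^ 2)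
            + 2 * (κ + p * exp (-(a * u)) + r * exp (b * u))
              * (-(a * p) * exp (-(a * u)) + b * r * exp (b * u)) ^ 2 := by
  have h1 : 0 < a * b * (-(p * exp (-(a * u))) - r * exp (b * u))
      * (1 + (κ + p * exp (-(a * u)) + r * exp (b * u)) ^ 2) := by
    have hpE : 0 < -(p * exp (-(a * u))) := by
      rw [neg_pos]; exact mul_neg_of_neg_of_pos hp (exp_pos _)
    have hrE : 0 ≤ -(r * exp (b * u)) := by
      rw [neg_nonneg]; exact mul_nonpos_of_nonpos_of_nonneg hr (exp_pos _).le
    have : 0 < -(p * exp (-(a * u))) - r * exp (b * u) := by linarith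
    exact mul_pos (mul_pos (mul_pos ha hb) this) (by positivity)
  have h2 : 0 ≤ 2 * (κ + p * exp (-(a * u)) + r * exp (b * u))
      * (-(a * p) * exp (-(a * u)) + b * r * exp (b * u)) ^ 2 :=
    mul_nonneg (mul_nonneg (by norm_num) hy) (sq_nonneg _)
  linarith

/-- **(ii) OUT-OF-PHASE BUT FLAT rows are compatible**: `0 ≤ a`, `0 ≤ b`, `0 ≤ κ`, phase `y ≤ 0` and slope
`2 y'² ≤ ab(1 + y²)`. [this file's theorem] -/
theorem compatible_of_flat (a b κ p r u : ℝ) (ha : 0 ≤ a) (hb : 0 ≤ b) (hκ : 0 ≤ κ)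
    (hy : κ + p * exp (-(a * u)) + r * exp (b * u) ≤ 0)
    (hflat : 2 * (-(a * p) * exp (-(a * u)) + b * r * exp (b * u)) ^ 2
      ≤ a * b * (1 + (κ + p * exp (-(a * u)) + r * exp (b * u)) ^ 2)) :
    0 ≤ a * b * (-(p * exp (-(a * u))) - r * exp (b * u))
              * (1 + (κ + p * exp (-(a * u)) + r * exp (b * u)) ^ 2)
            + 2 * (κ + p * exp (-(a * u)) + r * exp (b * u))
              * (-(a * p) * exp (-(a * u)) + b * r * exp (b * u)) ^ 2 := by
  -- write `Y = -y ≥ 0`; the depth is `κ + Y ≥ Y`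
  set y := κ + p * exp (-(a * u)) + r * exp (b * u) with hydef
  set s := (-(a * p) * exp (-(a * u)) + b * r * exp (b * u)) with hsdef
  have hdepth : -(p * exp (-(a * u))) - r * exp (b * u) = κ - y := by rw [hydef]; ring
  rw [hdepth]
  have hY : 0 ≤ -y := by linarith
  have hab : 0 ≤ a * b := mul_nonneg ha hb
  -- ab(κ - y)(1+y²) ≥ ab(-y)(1+y²) ≥ (-y)·2 s²
  have h1 : a * b * (-y) * (1 + y ^ 2) ≤ a * b * (κ - y) * (1 + y ^ 2) := by
    have : a * b * (-y) ≤ a * b * (κ - y) := by nlinarith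
    exact mul_le_mul_of_nonneg_right this (by positivity)
  have h2 : (-y) * (2 * s ^ 2) ≤ (-y) * (a * b * (1 + y ^ 2)) :=
    mul_le_mul_of_nonneg_left hflat hY
  nlinarith

/-- **Derivative of the symmetric company velocity** `e^{(a-b)u}·Θ'`. [this file's theorem] -/
theorem hasDerivAt_symVelocity (a b κ u : ℝ) (p r : ι → ℝ) :
    HasDerivAt (fun u => ∑ i, exp ((a - b) * u) * ((-(a * p i) * exp (-(a * u)) + b * r i * exp (b * u))
        / (1 + (κ + p i * exp (-(a * u)) + r i * exp (b * u)) ^ 2)))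
      (∑ i, -(exp ((a - b) * u)
        * (a * b * (-(p i * exp (-(a * u))) - r i * exp (b * u))
              * (1 + (κ + p i * exp (-(a * u)) + r i * exp (b * u)) ^ 2)
            + 2 * (κ + p i * exp (-(a * u)) + r i * exp (b * u))
              * (-(a * p i) * exp (-(a * u)) + b * r i * exp (b * u)) ^ 2)
          / (1 + (κ + p i * exp (-(a * u)) + r i * exp (b * u)) ^ 2) ^ 2)) u := by
  have h := HasDerivAt.sum (u := (Finset.univ : Finset ι))
    (fun i _ => hasDerivAt_symSummand a b κ (p i) (r i) u)
  have e : (∑ i, fun v : ℝ => exp ((a - b) * v) * ((-(a * p i) * exp (-(a * v)) + b * r i * exp (b * v))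
        / (1 + (κ + p i * exp (-(a * v)) + r i * exp (b * v)) ^ 2)))
      = fun v => ∑ i, exp ((a - b) * v) * ((-(a * p i) * exp (-(a * v)) + b * r i * exp (b * v))
        / (1 + (κ + p i * exp (-(a * v)) + r i * exp (b * v)) ^ 2)) := by
    funext v
    exact Finset.sum_apply v Finset.univ _
  rw [e] at h
  exact h

/-- the symmetric company velocity is `e^{(a-b)u}` times the phase velocity. [this file's lemma] -/
theorem symVelocity_eq (a b κ u : ℝ) (p r : ι → ℝ) :
    ∑ i, exp ((a - b) * u) * ((-(a * p i) * exp (-(a * u)) + b * r i * exp (b * u))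
        / (1 + (κ + p i * exp (-(a * u)) + r i * exp (b * u)) ^ 2))
      = exp ((a - b) * u) * ∑ i, (-(a * p i) * exp (-(a * u)) + b * r i * exp (b * u))
        / (1 + (κ + p i * exp (-(a * u)) + r i * exp (b * u)) ^ 2) := by
  rw [Finset.mul_sum]

/-- **COMPATIBILITY LAW, company form**: every row compatible, one strictly ⇒ `(e^{(a-b)u}Θ')' < 0`.
[this file's theorem] -/
theorem symVelocity_deriv_neg (a b κ u : ℝ) (p r : ι → ℝ)
    (hc : ∀ i, 0 ≤ a * b * (-(p i * exp (-(a * u))) - r i * exp (b * u))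
              * (1 + (κ + p i * exp (-(a * u)) + r i * exp (b * u)) ^ 2)
            + 2 * (κ + p i * exp (-(a * u)) + r i * exp (b * u))
              * (-(a * p i) * exp (-(a * u)) + b * r i * exp (b * u)) ^ 2)
    (i₀ : ι) (hi₀ : 0 < a * b * (-(p i₀ * exp (-(a * u))) - r i₀ * exp (b * u))
              * (1 + (κ + p i₀ * exp (-(a * u)) + r i₀ * exp (b * u)) ^ 2)
            + 2 * (κ + p i₀ * exp (-(a * u)) + r i₀ * exp (b * u))
              * (-(a * p i₀) * exp (-(a * u)) + b * r i₀ * exp (b * u)) ^ 2) :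
    (∑ i, -(exp ((a - b) * u)
        * (a * b * (-(p i * exp (-(a * u))) - r i * exp (b * u))
              * (1 + (κ + p i * exp (-(a * u)) + r i * exp (b * u)) ^ 2)
            + 2 * (κ + p i * exp (-(a * u)) + r i * exp (b * u))
              * (-(a * p i) * exp (-(a * u)) + b * r i * exp (b * u)) ^ 2)
          / (1 + (κ + p i * exp (-(a * u)) + r i * exp (b * u)) ^ 2) ^ 2)) < 0 := by
  classical
  have hlt := symSummand_deriv_neg_of_compatible a b κ (p i₀) (r i₀) u hi₀
  rw [← Finset.add_sum_erase Finset.univ _ (Finset.mem_univ i₀)]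
  have hrest := Finset.sum_nonpos (s := Finset.univ.erase i₀)
    (fun i _ => symSummand_deriv_nonpos_of_compatible a b κ (p i) (r i) u (hc i))
  linarith

/-- **COMPATIBILITY LAW, window form**: on a convex window where every row is compatible at every point and a fixed
row `i₀` is strictly compatible, `e^{(a-b)u}Θ'` is strictly decreasing. [this file's theorem] -/
theorem symVelocity_strictAntiOn (a b κ : ℝ) (p r : ι → ℝ) (W : Set ℝ) (hW : Convex ℝ W)
    (hc : ∀ u ∈ W, ∀ i, 0 ≤ a * b * (-(p i * exp (-(a * u))) - r i * exp (b * u))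
              * (1 + (κ + p i * exp (-(a * u)) + r i * exp (b * u)) ^ 2)
            + 2 * (κ + p i * exp (-(a * u)) + r i * exp (b * u))
              * (-(a * p i) * exp (-(a * u)) + b * r i * exp (b * u)) ^ 2)
    (i₀ : ι) (hi₀ : ∀ u ∈ W, 0 < a * b * (-(p i₀ * exp (-(a * u))) - r i₀ * exp (b * u))
              * (1 + (κ + p i₀ * exp (-(a * u)) + r i₀ * exp (b * u)) ^ 2)
            + 2 * (κ + p i₀ * exp (-(a * u)) + r i₀ * exp (b * u))
              * (-(a * p i₀) * exp (-(a * u)) + b * r i₀ * exp (b * u)) ^ 2) :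
    StrictAntiOn (fun u => ∑ i, exp ((a - b) * u) * ((-(a * p i) * exp (-(a * u)) + b * r i * exp (b * u))
        / (1 + (κ + p i * exp (-(a * u)) + r i * exp (b * u)) ^ 2))) W := by
  apply strictAntiOn_of_deriv_neg hW
  · exact fun u _ => (hasDerivAt_symVelocity a b κ u p r).continuousAt.continuousWithinAt
  · intro u hu
    rw [(hasDerivAt_symVelocity a b κ u p r).deriv]
    exact symVelocity_deriv_neg a b κ u p r (hc u (interior_subset hu)) i₀ (hi₀ u (interior_subset hu))

/-- **COMPATIBILITY LAW for the phase velocity**: on such a window `Θ' = -F₁` vanishes at most once.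
[this file's theorem] -/
theorem phaseVelocity_zero_subsingleton_sym (a b κ : ℝ) (p r : ι → ℝ) (W : Set ℝ) (hW : Convex ℝ W)
    (hc : ∀ u ∈ W, ∀ i, 0 ≤ a * b * (-(p i * exp (-(a * u))) - r i * exp (b * u))
              * (1 + (κ + p i * exp (-(a * u)) + r i * exp (b * u)) ^ 2)
            + 2 * (κ + p i * exp (-(a * u)) + r i * exp (b * u))
              * (-(a * p i) * exp (-(a * u)) + b * r i * exp (b * u)) ^ 2)
    (i₀ : ι) (hi₀ : ∀ u ∈ W, 0 < a * b * (-(p i₀ * exp (-(a * u))) - r i₀ * exp (b * u))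
              * (1 + (κ + p i₀ * exp (-(a * u)) + r i₀ * exp (b * u)) ^ 2)
            + 2 * (κ + p i₀ * exp (-(a * u)) + r i₀ * exp (b * u))
              * (-(a * p i₀) * exp (-(a * u)) + b * r i₀ * exp (b * u)) ^ 2) :
    {u ∈ W | ∑ i, (-(a * p i) * exp (-(a * u)) + b * r i * exp (b * u))
        / (1 + (κ + p i * exp (-(a * u)) + r i * exp (b * u)) ^ 2) = 0}.Subsingleton := by
  have hanti := symVelocity_strictAntiOn a b κ p r W hW hc i₀ hi₀
  intro u hu v hv
  rw [Set.mem_setOf_eq] at hu hv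
  have hu' : ∑ i, exp ((a - b) * u) * ((-(a * p i) * exp (-(a * u)) + b * r i * exp (b * u))
        / (1 + (κ + p i * exp (-(a * u)) + r i * exp (b * u)) ^ 2)) = 0 := by
    rw [symVelocity_eq, hu.2, mul_zero]
  have hv' : ∑ i, exp ((a - b) * v) * ((-(a * p i) * exp (-(a * v)) + b * r i * exp (b * v))
        / (1 + (κ + p i * exp (-(a * v)) + r i * exp (b * v)) ^ 2)) = 0 := by
    rw [symVelocity_eq, hv.2, mul_zero]
  exact hanti.injOn hu.1 hv.1 (hu'.trans hv'.symm)

end Summit.ValiantsHypothesis.ValiantsHypothesis.Theorems.LacunarySymmetroidMatrixDescartes.ProductPlusOne.LensCloudSymmetric
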